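import Mathlib

/-!
# Route PositionalGames — support item `MpgHardNpLanguage` (stmt-PneNP-1300): lassos of a self-map

Helper file (orbit combinatorics) for the proof of
`Summit.PneNP.PneNP.Theses.PositionalGames.MpgHardNpLanguage`. The route's inline encoding of a
positional play is the orbit `t ↦ f^[t] v` of a self-map `f` of `Fin n` (the two positional
strategies merged), and "the cycle of the lasso" is the set of vertices visited infinitely often,
`{u | ∃ᶠ t in atTop, f^[t] v = u}`. This file proves the elementary facts about that set used by
the NP-membership argument:

* `iterate_periodic` — after a repetition `f^[i] v = f^[j] v` the orbit is `(j - i)`-periodic;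
* `frequently_iff_exists_mem_Ico` — the infinitely-visited set is one period `{f^[t] v | i ≤ t < j}`;
* `exists_first_repetition` — on a finite type a FIRST repetition exists, before which the orbit is
  injective;
* `card_cycle_eq`, `sum_cycle_eq` — cardinality of / sums over the cycle as sums over one period;
* `mul_card_cycle_le_sum` — summing a potential inequality `Φ (f u) + K ≤ Φ u + g u` around the
  cycle telescopes to `K · |C| ≤ Σ_{u ∈ C} g u` (the soundness step of potential certificates for
  mean-payoff-type cycle conditions).

All folklore (eventually periodic sequences; Zwick–Paterson 1996 §2 uses exactly this telescoping).
-/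

namespace Summit.PneNP.PneNP.Theorems.MpgNP

set_option linter.dupNamespace false -- `Summit.PneNP.PneNP.…`: summit = sub-problem (D-0017)

open Filter Finset

variable {α : Type*}

/-- After a repetition `f^[i] v = f^[j] v` (`i ≤ j`) the orbit of `v` is `(j - i)`-periodic from
time `i` on. [folklore] -/
theorem iterate_periodic (f : α → α) (v : α) {i j : ℕ} (hij : i ≤ j) (h : f^[i] v = f^[j] v)
    {t : ℕ} (ht : i ≤ t) : f^[t + (j - i)] v = f^[t] v := by
  obtain ⟨s, rfl⟩ := Nat.exists_eq_add_of_le ht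
  have e1 : i + s + (j - i) = s + j := by omega
  rw [e1, Function.iterate_add_apply, ← h, ← Function.iterate_add_apply, Nat.add_comm]

/-- Iterating the period: `f^[t + q (j - i)] v = f^[t] v` for `t ≥ i`. [folklore] -/
theorem iterate_periodic_mul (f : α → α) (v : α) {i j : ℕ} (hij : i ≤ j) (h : f^[i] v = f^[j] v)
    {t : ℕ} (ht : i ≤ t) (q : ℕ) : f^[t + q * (j - i)] v = f^[t] v := by
  induction q with
  | zero => simp
  | succ q ih =>
    have e1 : t + (q + 1) * (j - i) = (t + q * (j - i)) + (j - i) := by ring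
    rw [e1, iterate_periodic f v hij h (by omega), ih]

/-- Every time `t ≥ i` is congruent, along the orbit, to a time in the period window `[i, j)`.
[folklore] -/
theorem exists_mem_Ico_iterate_eq (f : α → α) (v : α) {i j : ℕ} (hij : i < j)
    (h : f^[i] v = f^[j] v) : ∀ t, i ≤ t → ∃ s, i ≤ s ∧ s < j ∧ f^[t] v = f^[s] v := by
  intro t
  induction t using Nat.strong_induction_on with
  | _ t ih =>
    intro ht
    by_cases htj : t < j
    · exact ⟨t, ht, htj, rfl⟩
    · have h1 : i ≤ t - (j - i) := by omega
      have h2 : t - (j - i) < t := by omega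
      obtain ⟨s, hs1, hs2, hs3⟩ := ih _ h2 h1
      refine ⟨s, hs1, hs2, ?_⟩
      rw [← hs3, ← iterate_periodic f v hij.le h h1]
      congr 1
      omega

/-- **The infinitely-visited set is one period.** After a repetition `f^[i] v = f^[j] v`, `i < j`,
a point is visited infinitely often iff it is visited at a time in `[i, j)`. [folklore] -/
theorem frequently_iff_exists_mem_Ico (f : α → α) (v : α) {i j : ℕ} (hij : i < j)
    (h : f^[i] v = f^[j] v) (u : α) :
    (∃ᶠ t in atTop, f^[t] v = u) ↔ ∃ s, i ≤ s ∧ s < j ∧ f^[s] v = u := by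
  rw [frequently_atTop]
  constructor
  · intro H
    obtain ⟨t, ht, htu⟩ := H i
    obtain ⟨s, hs1, hs2, hs3⟩ := exists_mem_Ico_iterate_eq f v hij h t ht
    exact ⟨s, hs1, hs2, hs3 ▸ htu⟩
  · rintro ⟨s, hs1, hs2, hsu⟩ N
    refine ⟨s + N * (j - i), ?_, ?_⟩
    · have : 1 ≤ j - i := by omega
      nlinarith
    · rw [iterate_periodic_mul f v hij.le h hs1, hsu]

/-- The cycle (infinitely-visited set) as the image of one period window. [folklore] -/
theorem cycle_eq_image [DecidableEq α] (f : α → α) (v : α) {i j : ℕ} (hij : i < j)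
    (h : f^[i] v = f^[j] v) (C : Finset α) (hC : ∀ u, u ∈ C ↔ ∃ᶠ t in atTop, f^[t] v = u) :
    C = (Finset.Ico i j).image (fun t => f^[t] v) := by
  ext u
  rw [hC, frequently_iff_exists_mem_Ico f v hij h, Finset.mem_image]
  constructor
  · rintro ⟨s, hs1, hs2, hsu⟩
    exact ⟨s, Finset.mem_Ico.2 ⟨hs1, hs2⟩, hsu⟩
  · rintro ⟨s, hs, hsu⟩
    exact ⟨s, (Finset.mem_Ico.1 hs).1, (Finset.mem_Ico.1 hs).2, hsu⟩

/-- **Cardinality of the cycle**: if the orbit is injective on the period window `[i, j)` then the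
cycle has exactly `j - i` elements. [folklore] -/
theorem card_cycle_eq [DecidableEq α] (f : α → α) (v : α) {i j : ℕ} (hij : i < j)
    (h : f^[i] v = f^[j] v)
    (hinj : ∀ s t, i ≤ s → s < j → i ≤ t → t < j → f^[s] v = f^[t] v → s = t)
    (C : Finset α) (hC : ∀ u, u ∈ C ↔ ∃ᶠ t in atTop, f^[t] v = u) : C.card = j - i := by
  rw [cycle_eq_image f v hij h C hC, Finset.card_image_of_injOn, Nat.card_Ico]
  intro s hs t ht hst
  rw [Finset.coe_Ico, Set.mem_Ico] at hs ht
  exact hinj s t hs.1 hs.2 ht.1 ht.2 hst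

/-- **Sums over the cycle** are sums over one period window (orbit injective there). [folklore] -/
theorem sum_cycle_eq [DecidableEq α] {M : Type*} [AddCommMonoid M] (f : α → α) (v : α) {i j : ℕ}
    (hij : i < j) (h : f^[i] v = f^[j] v)
    (hinj : ∀ s t, i ≤ s → s < j → i ≤ t → t < j → f^[s] v = f^[t] v → s = t)
    (C : Finset α) (hC : ∀ u, u ∈ C ↔ ∃ᶠ t in atTop, f^[t] v = u) (g : α → M) :
    ∑ u ∈ C, g u = ∑ t ∈ Finset.Ico i j, g (f^[t] v) := by
  rw [cycle_eq_image f v hij h C hC, Finset.sum_image]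
  intro s hs t ht hst
  rw [Finset.coe_Ico, Set.mem_Ico] at hs ht
  exact hinj s t hs.1 hs.2 ht.1 ht.2 hst

/-- On a finite type every orbit has a repetition within `card α` steps. [folklore] -/
theorem exists_repetition [Fintype α] (f : α → α) (v : α) :
    ∃ j, j ≤ Fintype.card α ∧ ∃ i, i < j ∧ f^[i] v = f^[j] v := by
  have hlt : Fintype.card α < Fintype.card (Fin (Fintype.card α + 1)) := by simp
  obtain ⟨a, b, hab, he⟩ :=
    Fintype.exists_ne_map_eq_of_card_lt (fun t : Fin (Fintype.card α + 1) => f^[(t : ℕ)] v) hlt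
  rcases lt_or_gt_of_ne (Fin.val_ne_of_ne hab) with hlt' | hlt'
  · exact ⟨b, by omega, a, hlt', he⟩
  · exact ⟨a, by omega, b, hlt', he.symm⟩

/-- **First repetition.** On a finite type there are `i < j ≤ card α` with `f^[i] v = f^[j] v`
and the orbit injective before time `j`. [folklore] -/
theorem exists_first_repetition [Fintype α] (f : α → α) (v : α) :
    ∃ i j, i < j ∧ j ≤ Fintype.card α ∧ f^[i] v = f^[j] v ∧
      ∀ s t, s < j → t < j → f^[s] v = f^[t] v → s = t := by
  classical
  let P : ℕ → Prop := fun j => ∃ i, i < j ∧ f^[i] v = f^[j] v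
  obtain ⟨j₁, hj₁, i₁, hi₁, he₁⟩ := exists_repetition f v
  have hex : ∃ j, P j := ⟨j₁, i₁, hi₁, he₁⟩
  obtain ⟨i₀, hi₀, he₀⟩ : P (Nat.find hex) := Nat.find_spec hex
  have hmin : ∀ j', j' < Nat.find hex → ¬ P j' := fun j' hj' => Nat.find_min hex hj'
  refine ⟨i₀, Nat.find hex, hi₀, ?_, he₀, ?_⟩
  · exact (Nat.find_le ⟨i₁, hi₁, he₁⟩).trans hj₁
  · intro s t hs ht hst
    by_contra hne
    rcases lt_or_gt_of_ne hne with hlt | hlt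
    · exact hmin t ht ⟨s, hlt, hst⟩
    · exact hmin s hs ⟨t, hlt, hst.symm⟩

/-- Telescoping over one period: `Σ_{t ∈ [i,j)} Φ (f^[t+1] v) = Σ_{t ∈ [i,j)} Φ (f^[t] v)` when
`f^[i] v = f^[j] v`. [folklore] -/
theorem sum_Ico_iterate_succ_eq {M : Type*} [AddCommGroup M] (f : α → α) (v : α) {i j : ℕ}
    (hij : i < j) (h : f^[i] v = f^[j] v) (Φ : α → M) :
    ∑ t ∈ Finset.Ico i j, Φ (f^[t + 1] v) = ∑ t ∈ Finset.Ico i j, Φ (f^[t] v) := by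
  have h1 : ∑ t ∈ Finset.Ico i j, Φ (f^[t + 1] v) = ∑ t ∈ Finset.Ico (i + 1) (j + 1), Φ (f^[t] v) := by
    rw [← Finset.sum_Ico_add' (fun t => Φ (f^[t] v)) i j 1]
  rw [h1, Finset.sum_Ico_succ_top (by omega : i + 1 ≤ j), Finset.sum_eq_sum_Ico_succ_bot hij,
    ← h, add_comm]

/-- **Summing a potential inequality around the cycle.** If along the whole orbit
`Φ (f u) + K ≤ Φ u + g u` (natural numbers), then `K · |C| ≤ Σ_{u ∈ C} g u` for the cycle `C`
(the potentials telescope over one period of the first repetition). This is the soundness of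
potential certificates for cycle-mean conditions. [folklore] -/
theorem mul_card_cycle_le_sum [Fintype α] [DecidableEq α] (f : α → α) (v : α) (Φ g : α → ℕ) (K : ℕ)
    (hineq : ∀ t, Φ (f^[t + 1] v) + K ≤ Φ (f^[t] v) + g (f^[t] v))
    (C : Finset α) (hC : ∀ u, u ∈ C ↔ ∃ᶠ t in atTop, f^[t] v = u) :
    K * C.card ≤ ∑ u ∈ C, g u := by
  obtain ⟨i, j, hij, -, he, hinj⟩ := exists_first_repetition f v
  have hinj' : ∀ s t, i ≤ s → s < j → i ≤ t → t < j → f^[s] v = f^[t] v → s = t :=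
    fun s t _ hs _ ht hst => hinj s t hs ht hst
  rw [card_cycle_eq f v hij he hinj' C hC, sum_cycle_eq f v hij he hinj' C hC g]
  -- sum the inequality over the window and telescope (in ℤ)
  have hsum : ∑ t ∈ Finset.Ico i j, (Φ (f^[t + 1] v) + K) ≤
      ∑ t ∈ Finset.Ico i j, (Φ (f^[t] v) + g (f^[t] v)) :=
    Finset.sum_le_sum fun t _ => hineq t
  rw [Finset.sum_add_distrib, Finset.sum_add_distrib, Finset.sum_const, Nat.card_Ico,
    smul_eq_mul] at hsum
  have htel : ∑ t ∈ Finset.Ico i j, (Φ (f^[t + 1] v) : ℤ) = ∑ t ∈ Finset.Ico i j, (Φ (f^[t] v) : ℤ) :=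
    sum_Ico_iterate_succ_eq f v hij he (fun u => (Φ u : ℤ))
  have h1 : (∑ t ∈ Finset.Ico i j, Φ (f^[t + 1] v) : ℕ) = ∑ t ∈ Finset.Ico i j, Φ (f^[t] v) := by
    exact_mod_cast htel
  rw [h1] at hsum
  rw [Nat.mul_comm]
  omega

end Summit.PneNP.PneNP.Theorems.MpgNP
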